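import Literature.ModelTheory.ExponentialFields.DefinablyCompactBoxes
import HarnessLib

/-!
# Definable Heine–Cantor: continuous definable functions are uniformly continuous on closed bounded definable sets

Topic `Literature/ModelTheory/ExponentialFields`.  A consequence of the definable compactness of
closed boxes in all dimensions (`DefinablyCompactBoxes.lean`; Fornasiero–Servi, *Definably
complete Baire structures*, Fund. Math. 209 (2010), Lemma 1.8 (Miller) and §1.2, "most results
of elementary real analysis can be proved in every definably complete expansion of an ordered
field"): in a definably complete ordered field `K`, a definable function `f : Kⁿ → K` continuous
on a closed bounded definable set `C` is **uniformly continuous on `C`** for the sup-distance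
(`IsDefinablyComplete.exists_forall_abs_sub_lt_of_continuousOn_pi`).  If not, the closures of
the sets `{x ∈ C | ∃ x' ∈ C, |x - x'|_∞ ≤ δ, |f x - f x'| ≥ ε}`, `δ ↓ 0`, form a decreasing
definable family of closed non-empty subsets of `C` with a common point, at which `f` is not
continuous.  Also: `exists_pos_forall_abs_sub_lt_subset_of_mem_nhds` (neighbourhoods in `Kⁿ`
contain sup-balls) and `definable_oscillationFamily` (definability of the family above).

Everything is proved; no definitions.  Conventions (`hlt`, `hadd`) as in
`DefinablyCompactBoxes.lean`.

## References

* A. Fornasiero, T. Servi, *Definably complete Baire structures*, Fund. Math. 209 (2010),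
  §1.2, Lemma 1.8. [FornasieroServi2010]
-/

open Set FirstOrder FirstOrder.Language
open _root_.Filter _root_.Topology

namespace Literature.ModelTheory.ExponentialFields

universe u v

variable {K : Type*} [Field K] [LinearOrder K] [IsStrictOrderedRing K] [TopologicalSpace K]
  [OrderTopology K] {L : FirstOrder.Language.{u, v}} [L.Structure K]

omit [L.Structure K] in
/-- **Neighbourhoods in `Kⁿ` contain sup-balls**: if `t ∈ 𝓝 z` then for some `ρ > 0` every `w`
with `|wᵢ - zᵢ| < ρ` for all `i` lies in `t`. [folklore] -/
theorem exists_pos_forall_abs_sub_lt_subset_of_mem_nhds {n : ℕ} {z : Fin n → K} {t : Set (Fin n → K)}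
    (ht : t ∈ 𝓝 z) : ∃ ρ : K, 0 < ρ ∧ ∀ w : Fin n → K, (∀ i, |w i - z i| < ρ) → w ∈ t := by
  classical
  rw [nhds_pi] at ht
  obtain ⟨I, -, s, hs, hIs⟩ := Filter.mem_pi.1 ht
  have hcoord : ∀ i, ∃ l u, z i ∈ Ioo l u ∧ Ioo l u ⊆ s i := fun i =>
    mem_nhds_iff_exists_Ioo_subset.1 (hs i)
  choose l u hzlu hlus using hcoord
  rcases isEmpty_or_nonempty (Fin n) with hn | hn
  · exact ⟨1, one_pos, fun w _ => hIs fun i _ => (hn.false i).elim⟩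
  refine ⟨Finset.univ.inf' Finset.univ_nonempty fun i => min (z i - l i) (u i - z i), ?_, ?_⟩
  · refine (Finset.lt_inf'_iff _).2 fun i _ => lt_min ?_ ?_
    · exact sub_pos.2 (hzlu i).1
    · exact sub_pos.2 (hzlu i).2
  · intro w hw
    refine hIs fun i _ => hlus i ⟨?_, ?_⟩
    · have h1 : |w i - z i| < z i - l i :=
        (hw i).trans_le ((Finset.inf'_le _ (Finset.mem_univ i)).trans (min_le_left _ _))
      have := (abs_sub_lt_iff.1 h1).2
      linarith
    · have h1 : |w i - z i| < u i - z i :=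
        (hw i).trans_le ((Finset.inf'_le _ (Finset.mem_univ i)).trans (min_le_right _ _))
      have := (abs_sub_lt_iff.1 h1).1
      linarith

omit [TopologicalSpace K] [OrderTopology K] in
/-- The family, indexed by `s` (read `δ = -s`), of the sets of points `x ∈ C` having a partner
`x' ∈ C` with `|xᵢ - x'ᵢ| ≤ -s` for all `i` and `|f x - f x'| ≥ ε` is definable, as the set of
tuples `(s, x)` (used in the proof of the definable Heine–Cantor theorem below). [folklore] -/
theorem definable_oscillationFamily
    (hlt : (univ : Set K).Definable L {v : Fin 2 → K | v 0 < v 1})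
    (hadd : (univ : Set K).Definable L {v : Fin 3 → K | v 2 = v 0 + v 1})
    {n : ℕ} {C : Set (Fin n → K)} (hC : (univ : Set K).Definable L C)
    {f : (Fin n → K) → K} (hf : (univ : Set K).DefinableFun L f) (ε : K) :
    (univ : Set K).Definable L {v : Fin (n + 1) → K | Fin.tail v ∈
      {x : Fin n → K | x ∈ C ∧ ∃ x' : Fin n → K, x' ∈ C ∧
        (∀ i, x i ≤ x' i + -(v 0) ∧ x' i ≤ x i + -(v 0)) ∧
          (f x' + ε ≤ f x ∨ f x + ε ≤ f x')}} := by
  have hneg : (univ : Set K).Definable L {v : Fin 2 → K | v 1 = (fun s => -s) (v 0)} :=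
    definable_graph_neg hadd (f := fun s => s)
      (definable_setOf_eq_params (definableFun_proj_params 1) (definableFun_proj_params 0))
  -- variables `z : Fin (n + 1) ⊕ Fin n → K`: `s = z (inl 0)`, `x i = z (inl i.succ)`, `x' i = z (inr i)`
  have hs : (univ : Set K).DefinableFun L (fun z : Fin (n + 1) ⊕ Fin n → K => -z (Sum.inl 0)) :=
    definableFun_apply_params (f := fun s => -s) hneg (definableFun_proj_params _)
  have hfx : (univ : Set K).DefinableFun L
      (fun z : Fin (n + 1) ⊕ Fin n → K => f fun i => z (Sum.inl i.succ)) :=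
    hf.comp fun i => definableFun_proj_params (L := L) (A := (univ : Set K)) (Sum.inl i.succ)
  have hfx' : (univ : Set K).DefinableFun L
      (fun z : Fin (n + 1) ⊕ Fin n → K => f fun i => z (Sum.inr i)) :=
    hf.comp fun i => definableFun_proj_params (L := L) (A := (univ : Set K)) (Sum.inr i)
  have hC₁ : (univ : Set K).Definable L
      {z : Fin (n + 1) ⊕ Fin n → K | (fun i => z (Sum.inl i.succ)) ∈ C} :=
    hC.preimage_comp fun i : Fin n => Sum.inl i.succ
  have hC₂ : (univ : Set K).Definable L
      {z : Fin (n + 1) ⊕ Fin n → K | (fun i => z (Sum.inr i)) ∈ C} :=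
    hC.preimage_comp fun i : Fin n => Sum.inr i
  have hbox : (univ : Set K).Definable L {z : Fin (n + 1) ⊕ Fin n → K |
      ∀ i : Fin n, z (Sum.inl i.succ) ≤ z (Sum.inr i) + -z (Sum.inl 0) ∧
        z (Sum.inr i) ≤ z (Sum.inl i.succ) + -z (Sum.inl 0)} := by
    have h := definable_iInter_of_finite (L := L) (A := (univ : Set K)) fun i : Fin n =>
      (definable_setOf_le_params hlt (definableFun_proj_params (Sum.inl i.succ))
        (definableFun_apply₂_params hadd (definableFun_proj_params (Sum.inr i)) hs)).inter
      (definable_setOf_le_params hlt (definableFun_proj_params (Sum.inr i))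
        (definableFun_apply₂_params hadd (definableFun_proj_params (Sum.inl i.succ)) hs))
    refine (congrArg _ ?_).mpr h
    ext z
    simp only [mem_setOf_eq, mem_iInter, mem_inter_iff]
  have hosc : (univ : Set K).Definable L {z : Fin (n + 1) ⊕ Fin n → K |
      (f fun i => z (Sum.inr i)) + ε ≤ (f fun i => z (Sum.inl i.succ)) ∨
        (f fun i => z (Sum.inl i.succ)) + ε ≤ f fun i => z (Sum.inr i)} :=
    (definable_setOf_le_params hlt
      (definableFun_apply₂_params hadd hfx' (definableFun_const_params _ (mem_univ ε))) hfx).union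
    (definable_setOf_le_params hlt
      (definableFun_apply₂_params hadd hfx (definableFun_const_params _ (mem_univ ε))) hfx')
  have hT := hC₁.inter ((hC₂.inter hbox).inter hosc)
  have hE := hT.exists_of_finite (α := Fin (n + 1)) (β := Fin n)
  refine (congrArg _ ?_).mpr hE
  ext v
  simp only [mem_setOf_eq, mem_inter_iff, Sum.elim_inl, Sum.elim_inr, Fin.tail]
  constructor
  · rintro ⟨hxC, x', hx'C, hb, ho⟩
    exact ⟨x', hxC, ⟨hx'C, hb⟩, ho⟩
  · rintro ⟨x', hxC, ⟨hx'C, hb⟩, ho⟩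
    exact ⟨hxC, x', hx'C, hb, ho⟩

set_option maxHeartbeats 400000 in
/-- **Definable Heine–Cantor theorem**: in a definably complete ordered field with `<`, `+`
definable, a definable function `f : Kⁿ → K` continuous on a closed bounded definable set `C` is
uniformly continuous on `C` for the sup-distance: for every `ε > 0` there is `δ > 0` with
`|f x - f x'| < ε` whenever `x, x' ∈ C` and `|xᵢ - x'ᵢ| < δ` for all `i`.  (Otherwise the
closures of `{x ∈ C | ∃ x' ∈ C, |x - x'|_∞ ≤ δ, |f x - f x'| ≥ ε}`, `δ ↓ 0`, are a decreasing
definable family of closed non-empty subsets of `C`; at a common point, given by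
`exists_forall_mem_of_antitone_pi`, `f` fails to be continuous.) [cite: FornasieroServi2010, Lemma 1.8] -/
theorem _root_.FirstOrder.Language.IsDefinablyComplete.exists_forall_abs_sub_lt_of_continuousOn_pi
    (hDC : L.IsDefinablyComplete K)
    (hlt : (univ : Set K).Definable L {v : Fin 2 → K | v 0 < v 1})
    (hadd : (univ : Set K).Definable L {v : Fin 3 → K | v 2 = v 0 + v 1})
    {n : ℕ} {C : Set (Fin n → K)} (hC : (univ : Set K).Definable L C) (hCcl : IsClosed C)
    {a b : K} (hCsub : ∀ x ∈ C, ∀ i, a ≤ x i ∧ x i ≤ b)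
    {f : (Fin n → K) → K} (hf : (univ : Set K).DefinableFun L f) (hcont : ContinuousOn f C)
    {ε : K} (hε : 0 < ε) :
    ∃ δ : K, 0 < δ ∧ ∀ x ∈ C, ∀ x' ∈ C, (∀ i, |x i - x' i| < δ) → |f x - f x'| < ε := by
  classical
  by_contra hnot
  push Not at hnot
  -- `hnot : ∀ δ > 0, ∃ x ∈ C, ∃ x' ∈ C, (∀ i, |x i - x' i| < δ) ∧ ε ≤ |f x - f x'|`
  -- the bad sets `W s` (`δ = -s`) and their closures
  set W : K → Set (Fin n → K) := fun s => {x | x ∈ C ∧ ∃ x' : Fin n → K, x' ∈ C ∧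
      (∀ i, x i ≤ x' i + -s ∧ x' i ≤ x i + -s) ∧ (f x' + ε ≤ f x ∨ f x + ε ≤ f x')} with hW
  set Y : K → Set (Fin n → K) := fun s => closure (W s) with hY
  set N : Set K := Iio 0 with hN
  have hNdef : (univ : Set K).Definable₁ L N := by
    have h : (univ : Set K).Definable L {v : Fin 1 → K | v 0 < 0} :=
      definable_setOf_lt_params hlt (definableFun_proj_params 0)
        (definableFun_const_params _ (mem_univ _))
    simpa [Set.Definable₁, hN] using h
  have hNne : N.Nonempty := exists_lt (0 : K)
  -- definability of `W` as a family (`definable_oscillationFamily`)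
  have hWdef : (univ : Set K).Definable L {v : Fin (n + 1) → K | Fin.tail v ∈ W (v 0)} := by
    simp only [hW]
    exact definable_oscillationFamily hlt hadd hC hf ε
  have hYdef := definable_family_closure (n := n) (W := W) hlt hWdef
  have hWanti : ∀ s ∈ N, ∀ s' ∈ N, s ≤ s' → W s' ⊆ W s := by
    rintro s - s' - hss' x ⟨hxC, x', hx'C, hb, ho⟩
    refine ⟨hxC, x', hx'C, fun i => ⟨?_, ?_⟩, ho⟩
    · linarith [(hb i).1]
    · linarith [(hb i).2]
  have hanti : ∀ s ∈ N, ∀ s' ∈ N, s ≤ s' → Y s' ⊆ Y s := fun s hs s' hs' hss' =>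
    closure_mono (hWanti s hs s' hs' hss')
  have hcl : ∀ s ∈ N, IsClosed (Y s) := fun _ _ => isClosed_closure
  have hne : ∀ s ∈ N, (Y s).Nonempty := by
    intro s hs
    obtain ⟨x, hxC, x', hx'C, hd, hfe⟩ := hnot (-s) (neg_pos.2 hs)
    refine ⟨x, subset_closure ⟨hxC, x', hx'C, fun i => ?_, ?_⟩⟩
    · have h := abs_sub_lt_iff.1 (hd i)
      constructor <;> linarith [h.1, h.2]
    · rcases le_abs.1 hfe with h | h
      · left; linarith
      · right; linarith
  have hWsub : ∀ s, W s ⊆ C := fun s x hx => hx.1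
  have hsub : ∀ s ∈ N, ∀ x ∈ Y s, ∀ i, a ≤ x i ∧ x i ≤ b := fun s _ x hx =>
    hCsub x ((closure_minimal (hWsub s) hCcl) hx)
  obtain ⟨x₀, hx₀⟩ := hDC.exists_forall_mem_of_antitone_pi hlt hadd n (N := N) (Y := Y) hNdef
    hNne hYdef hanti hcl hne hsub
  obtain ⟨s₁, hs₁⟩ := hNne
  have hx₀C : x₀ ∈ C := (closure_minimal (hWsub s₁) hCcl) (hx₀ s₁ hs₁)
  -- continuity of `f` at `x₀` within `C`: a sup-ball of radius `ρ` on which `|f z - f x₀| < ε/2`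
  have hε2 : 0 < ε / 2 := half_pos hε
  have hpre : f ⁻¹' Ioo (f x₀ - ε / 2) (f x₀ + ε / 2) ∈ 𝓝[C] x₀ :=
    hcont x₀ hx₀C (Ioo_mem_nhds (by linarith) (by linarith))
  obtain ⟨t, ht, htC⟩ := mem_nhdsWithin_iff_exists_mem_nhds_inter.1 hpre
  obtain ⟨ρ, hρ, hρt⟩ := exists_pos_forall_abs_sub_lt_subset_of_mem_nhds ht
  have hclose : ∀ z ∈ C, (∀ i, |z i - x₀ i| < ρ) → |f z - f x₀| < ε / 2 := by
    intro z hzC hz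
    have h := htC ⟨hρt z hz, hzC⟩
    simp only [mem_preimage, mem_Ioo] at h
    rw [abs_sub_lt_iff]
    constructor <;> linarith [h.1, h.2]
  -- a point of `W (-ρ/2)` within `ρ/2` of `x₀`
  have hρ2 : 0 < ρ / 2 := half_pos hρ
  have hmem := hx₀ (-(ρ / 2)) (by simpa [hN] using hρ2)
  simp only [hY] at hmem
  rw [mem_closure_iff_forall_box] at hmem
  obtain ⟨x, ⟨hxC, x', hx'C, hb, ho⟩, hxbox⟩ := hmem (fun i => x₀ i - ρ / 2) (fun i => x₀ i + ρ / 2)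
    fun i => ⟨by linarith, by linarith⟩
  have hx : ∀ i, |x i - x₀ i| < ρ := by
    intro i
    rw [abs_sub_lt_iff]
    constructor <;> linarith [(hxbox i).1, (hxbox i).2]
  have hx' : ∀ i, |x' i - x₀ i| < ρ := by
    intro i
    have h1 := (hb i).1
    have h2 := (hb i).2
    rw [neg_neg] at h1 h2
    rw [abs_sub_lt_iff]
    constructor <;> linarith [(hxbox i).1, (hxbox i).2]
  have h1 := abs_sub_lt_iff.1 (hclose x hxC hx)
  have h2 := abs_sub_lt_iff.1 (hclose x' hx'C hx')
  rcases ho with h | h <;> linarith [h1.1, h1.2, h2.1, h2.2]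

end Literature.ModelTheory.ExponentialFields
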